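import Mathlib
import Summits.KontsevichZagierPeriods.KontsevichZagierPeriods.Theorems.SoloInformedDivisionMove
import Summits.KontsevichZagierPeriods.KontsevichZagierPeriods.Theorems.SoloInformedLegendreArcsine
import Literature.NumberTheory.Transcendental.EllIterRep
import Literature.NumberTheory.Transcendental.KZDominatedFamilyRelations
import Literature.NumberTheory.Transcendental.KZLogCalculusProofs
import Literature.NumberTheory.Transcendental.KZRulesAssociator
import HarnessLib
import HarnessLib.Audit

/-!
# Division by translation III: division chains tile `K(m)` (solo-informed, s43)

Third file of LEMMA XXIX.1 KERNEL.  A DIVISION CHAIN of order `q` for the modulus `0 < m < 1`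
is a sequence `0 = s_0 < s_1 < ⋯ < s_q = 1` of real algebraic numbers generated by Jacobi's
addition map, `s_{j+1} = T_{s_j}(s_1)`, every step satisfying the turn condition
`s_1²(1 − m s_j²) ≤ 1 − s_j²`.  (Transcendentally: `s_j = sn(jK/q | m)`; the chain packages exactly
the algebraic content of "`s_1` is the abscissa of a real `q`-division point", with no elliptic
function in sight.)  By `q − 1` translation moves (part II) and domain additivity,

  `q·[F_1] = [K]`,  `[F_p] = p·[F_1]`,  hence  `q·[F_p] = p·[K]`  in `P`  (`0 ≤ p ≤ q`),

where `F_p = [(0,s_p), κ]`, `κ = ((1−t²)(1−m t²))^{-1/2}`, `K = [(0,1), κ] = K(m)`: the incomplete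
integral of the first kind at a real torsion point is EQUIVALENT (not merely equal in value) to
the corresponding rational multiple of the complete one — uniformly in the torsion order, given
the chain.  Orders `3` and `4` were done by hand in s40–s42 (Kummer, quartic units); this is the
general mechanism behind THEOREM XXIX(i).

References: C. G. J. Jacobi, *Fundamenta nova* (1829), §§18–20; N. H. Abel, *Recherches sur les
fonctions elliptiques*, Crelle 2–3 (1827–28), §§9–10 (division of the lemniscate and of `F`);
M. Kontsevich, D. Zagier, *Periods* (2001), §1.2; this work (solo-informed s43).
-/

noncomputable section

open MeasureTheory Set Filter
open scoped Classical

open Literature.NumberTheory.Transcendental Literature.NumberTheory.Transcendental.KZ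
open Literature.ModelTheory.ExponentialFields

namespace Summit.KontsevichZagierPeriods.KontsevichZagierPeriods.Theorems

/-- **A division chain of order `q` for the modulus `m`**: abscissae `s_0 = 0`, `0 < s_1 ≤ 1`
algebraic, `s_{j+1} = T_{s_j}(s_1)` and the turn condition `s_1²(1 − m s_j²) ≤ 1 − s_j²` for
`j < q`, and `s_q = 1`.  (Model: `s_j = sn(jK(m)/q | m)`.) [this work] -/
structure SoloInformedDivChain (m : ℝ) (q : ℕ) where
  /-- the abscissae `s_j` (only `j ≤ q` matter) -/
  s : ℕ → ℝ
  s_zero : s 0 = 0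
  one_pos : 0 < s 1
  one_le : s 1 ≤ 1
  one_isAlgebraic : IsAlgebraic ℚ (s 1)
  step : ∀ j, j < q → s (j + 1) = soloInformedAddm m (s j) (s 1)
  turn : ∀ j, j < q → s 1 ^ 2 * (1 - m * s j ^ 2) ≤ 1 - s j ^ 2
  top : s q = 1

/-! ### Elementary properties of a chain -/

/-- Every abscissa of a division chain lies in `[0,1]` and is algebraic. [this work] -/
theorem soloInformed_divChain_mem {m : ℝ} {q : ℕ} (c : SoloInformedDivChain m q)
    (hm : m ∈ Ioo (0:ℝ) 1) (hma : IsAlgebraic ℚ m) :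
    ∀ j, j ≤ q → c.s j ∈ Icc (0:ℝ) 1 ∧ IsAlgebraic ℚ (c.s j) := by
  intro j
  induction j with
  | zero =>
    intro _
    rw [c.s_zero]
    exact ⟨⟨le_rfl, zero_le_one⟩, isAlgebraic_zero⟩
  | succ j ih =>
    intro hj
    have hjq : j < q := hj
    obtain ⟨hI, ha⟩ := ih hjq.le
    have h1 : c.s 1 ∈ Icc (0:ℝ) 1 := ⟨c.one_pos.le, c.one_le⟩
    rw [c.step j hjq]
    exact ⟨⟨soloInformed_addm_nonneg hm hI h1, (soloInformed_addm_lt_one hm hI h1).1⟩,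
      soloInformed_addm_isAlgebraic hm hma hI ha h1 c.one_isAlgebraic⟩

/-- Before the top, the abscissae stay below `1` (the turn condition at `s_j = 1` would force
`s_1²(1 − m) ≤ 0`). [this work] -/
theorem soloInformed_divChain_lt_one {m : ℝ} {q : ℕ} (c : SoloInformedDivChain m q)
    (hm : m ∈ Ioo (0:ℝ) 1) (hma : IsAlgebraic ℚ m) {j : ℕ} (hj : j < q) : c.s j < 1 := by
  obtain ⟨hI, -⟩ := soloInformed_divChain_mem c hm hma j hj.le
  by_contra h
  have h1 : c.s j = 1 := le_antisymm hI.2 (not_lt.1 h)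
  have ht := c.turn j hj
  rw [h1] at ht
  nlinarith [c.one_pos, hm.2, mul_pos (pow_pos c.one_pos 2) (sub_pos.2 hm.2)]

/-- The abscissae increase strictly: `s_j < s_{j+1}` for `j < q`. [this work] -/
theorem soloInformed_divChain_lt_succ {m : ℝ} {q : ℕ} (c : SoloInformedDivChain m q)
    (hm : m ∈ Ioo (0:ℝ) 1) (hma : IsAlgebraic ℚ m) {j : ℕ} (hj : j < q) :
    c.s j < c.s (j + 1) := by
  rcases Nat.eq_zero_or_pos j with rfl | hj0
  · rw [c.s_zero, zero_add]; exact c.one_pos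
  · have hs1 : c.s 1 ∈ Ioo (0:ℝ) 1 :=
      ⟨c.one_pos, soloInformed_divChain_lt_one c hm hma (lt_of_le_of_lt hj0 hj)⟩
    have h := (soloInformed_addm_endpoint hm (soloInformed_divChain_mem c hm hma j hj.le).1 hs1
      (c.turn j hj)).1
    rwa [← c.step j hj] at h

/-! ### Splitting an open slab at an algebraic point -/

/-- Splitting `[(a,b), f]` at an algebraic point `a ≤ c ≤ b`:
`[(a,b), f] ∼ [(a,c), f] + [(c,b), f]` (the point `{c}` is null; rule 1a). [KZ 2001, §1.2 rule (1)] -/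
theorem soloInformed_slab_split (G : IntegralRep 1) {a c b : ℝ} (hac : a ≤ c) (hcb : c ≤ b)
    (haa : IsAlgebraic ℚ a) (hca : IsAlgebraic ℚ c) (hba : IsAlgebraic ℚ b)
    (hGd : G.domain = {x | x 0 ∈ Ioo a b}) :
    ∃ G₁ G₂ : IntegralRep 1, G₁.domain = {x | x 0 ∈ Ioo a c} ∧ G₂.domain = {x | x 0 ∈ Ioo c b} ∧
      G₁.integrand = G.integrand ∧ G₂.integrand = G.integrand ∧
      of G - of G₁ - of G₂ ∈ relations := by
  have hLo : IsSemialgebraic ℚ {x : Fin 1 → ℝ | x 0 ∈ Ioo a c} :=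
    (isSemialgebraic_setOf_const_lt_apply haa 0).inter (isSemialgebraic_setOf_apply_lt_const hca 0)
  have hHi : IsSemialgebraic ℚ {x : Fin 1 → ℝ | x 0 ∈ Ioo c b} :=
    (isSemialgebraic_setOf_const_lt_apply hca 0).inter (isSemialgebraic_setOf_apply_lt_const hba 0)
  have hlo : {x : Fin 1 → ℝ | x 0 ∈ Ioo a c} ⊆ G.domain := fun x hx => by
    rw [hGd]; exact ⟨hx.1, hx.2.trans_le hcb⟩
  have hup : {x : Fin 1 → ℝ | x 0 ∈ Ioo c b} ⊆ G.domain := fun x hx => by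
    rw [hGd]; exact ⟨hac.trans_lt hx.1, hx.2⟩
  have hE : {x : Fin 1 → ℝ | x 0 ∈ Ioo a c} ∪ {x : Fin 1 → ℝ | x 0 ∈ Ioo c b} ⊆ G.domain :=
    union_subset hlo hup
  have hvol : volume (G.domain \ ({x : Fin 1 → ℝ | x 0 ∈ Ioo a c} ∪
      {x : Fin 1 → ℝ | x 0 ∈ Ioo c b})) = 0 := by
    refine measure_mono_null (fun x hx => ?_) (BallPeeling.volume_setOf_apply_eq_const 1 0 c)
    rw [hGd] at hx
    simp only [Set.mem_sdiff, mem_setOf_eq, mem_union, mem_Ioo, not_or, not_and, not_lt] at hx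
    obtain ⟨⟨h0, h1⟩, hlo', hup'⟩ := hx
    have h2 : c ≤ x 0 := hlo' h0
    have h3 : x 0 ≤ c := by
      by_contra h
      exact absurd (hup' (not_le.mp h)) (not_le.2 h1)
    show x 0 = c
    exact le_antisymm h3 h2
  have h1 := IntegralRep.of_sub_of_restrict_mem_relations G (hLo.union hHi) hE hvol
  have h2 : of (G.restrict _ (hLo.union hHi) hE) - of (G.restrict _ hLo hlo) -
      of (G.restrict _ hHi hup) ∈ relations := by
    refine domainAddRel_subset_relations ⟨1, G.restrict _ (hLo.union hHi) hE,
      G.restrict _ hLo hlo, G.restrict _ hHi hup, rfl, ?_, fun _ _ => rfl, fun _ _ => rfl, rfl⟩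
    rw [IntegralRep.domain_restrict, IntegralRep.domain_restrict]
    have : {x : Fin 1 → ℝ | x 0 ∈ Ioo a c} ∩ {x : Fin 1 → ℝ | x 0 ∈ Ioo c b} = ∅ := by
      ext x
      simp only [mem_inter_iff, mem_setOf_eq, mem_Ioo, mem_empty_iff_false, iff_false, not_and]
      exact fun h h' _ => by linarith [h.2, h']
    rw [this, measure_empty]
  refine ⟨G.restrict _ hLo hlo, G.restrict _ hHi hup, rfl, rfl, rfl, rfl, ?_⟩
  have := relations.add_mem h1 h2
  convert this using 1
  abel

/-! ### The tiling theorem -/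

/-- **LEMMA XXIX.1-K (division by translation, first kind).**  For a division chain `(s_j)` of
order `q` (modulus `0 < m < 1` algebraic) and `F_1 = [(0,s_1), κ]`: every representation
`[(0,s_p), κ]`, `p ≤ q`, satisfies `[(0,s_p), κ] = p·[F_1]` in the formal period ring — by
induction on `p`, splitting `(0,s_{p+1})` at `s_p` and translating `(0,s_1)` onto `(s_p,s_{p+1})`
(`soloInformed_addm_translation_move`). [this work] -/
theorem soloInformed_divChain_tiling {m : ℝ} {q : ℕ} (c : SoloInformedDivChain m q)
    (hm : m ∈ Ioo (0:ℝ) 1) (hma : IsAlgebraic ℚ m) (F : IntegralRep 1)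
    (hFd : F.domain = {x | x 0 ∈ Ioo (0:ℝ) (c.s 1)})
    (hFi : EqOn F.integrand (fun x => (√(1 - x 0 ^ 2))⁻¹ * (√(1 - m * x 0 ^ 2))⁻¹) F.domain) :
    ∀ p, p ≤ q → ∀ G : IntegralRep 1, G.domain = {x | x 0 ∈ Ioo (0:ℝ) (c.s p)} →
      EqOn G.integrand (fun x => (√(1 - x 0 ^ 2))⁻¹ * (√(1 - m * x 0 ^ 2))⁻¹) G.domain →
      toFormalPeriod (of G) = (p : FormalPeriodRing) * toFormalPeriod (of F) := by
  intro p
  induction p with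
  | zero =>
    intro _ G hGd _
    have hvol : volume G.domain = 0 := by
      rw [hGd, c.s_zero]
      simp only [Ioo_self, mem_empty_iff_false, setOf_false, measure_empty]
    rw [Nat.cast_zero, zero_mul, toFormalPeriod_eq_zero_iff]
    exact KZ.of_mem_relations_of_volume_eq_zero G hvol
  | succ p ih =>
    intro hp1 G hGd hGi
    have hp : p < q := hp1
    rcases Nat.eq_zero_or_pos p with rfl | hp0
    · have h : of G - of F ∈ relations :=
        KZ.of_sub_of_mem_relations_of_eqOn (by rw [hFd, hGd]) fun x hx =>
          (hGi hx).trans (hFi (by rw [hFd]; rw [hGd] at hx; exact hx)).symm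
      rw [toFormalPeriod_eq_iff.mpr h, Nat.zero_add, Nat.cast_one, one_mul]
    · obtain ⟨hIp, hpa⟩ := soloInformed_divChain_mem c hm hma p hp.le
      obtain ⟨-, hp1a⟩ := soloInformed_divChain_mem c hm hma (p + 1) hp1
      have hs1 : c.s 1 ∈ Ioo (0:ℝ) 1 :=
        ⟨c.one_pos, soloInformed_divChain_lt_one c hm hma (lt_of_le_of_lt hp0 hp)⟩
      have hlt : c.s p < c.s (p + 1) := soloInformed_divChain_lt_succ c hm hma hp
      obtain ⟨G₁, G₂, hG₁d, hG₂d, hG₁i, hG₂i, hsplit⟩ :=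
        soloInformed_slab_split G hIp.1 hlt.le isAlgebraic_zero hpa hp1a hGd
      have h1 : toFormalPeriod (of G₁) = (p : FormalPeriodRing) * toFormalPeriod (of F) := by
        refine ih hp.le G₁ hG₁d fun x hx => ?_
        rw [hG₁i]
        refine hGi ?_
        rw [hGd]; rw [hG₁d] at hx
        exact ⟨hx.1, hx.2.trans hlt⟩
      have h2 : of F - of G₂ ∈ relations := by
        refine soloInformed_addm_translation_move hm hma hIp hpa hs1 c.one_isAlgebraic
          (c.turn p hp) F G₂ hFd (by rw [hG₂d, c.step p hp]) hFi fun x hx => ?_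
        rw [hG₂i]
        refine hGi ?_
        rw [hGd]; rw [hG₂d] at hx
        exact ⟨hIp.1.trans_lt hx.1, hx.2⟩
      have e1 : toFormalPeriod (of G) = toFormalPeriod (of G₁) + toFormalPeriod (of G₂) := by
        rw [← map_add, toFormalPeriod_eq_iff]
        convert hsplit using 1
        abel
      rw [e1, h1, ← toFormalPeriod_eq_iff.mpr h2, Nat.cast_succ, add_mul, one_mul]

/-- **`q·[F_1] = [K(m)]` in `P`** for a division chain of order `q`. [this work] -/
theorem soloInformed_divChain_period {m : ℝ} {q : ℕ} (c : SoloInformedDivChain m q)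
    (hm : m ∈ Ioo (0:ℝ) 1) (hma : IsAlgebraic ℚ m) (K F : IntegralRep 1)
    (hKd : K.domain = {x | x 0 ∈ Ioo (0:ℝ) 1})
    (hKi : EqOn K.integrand (fun x => (√(1 - x 0 ^ 2))⁻¹ * (√(1 - m * x 0 ^ 2))⁻¹) K.domain)
    (hFd : F.domain = {x | x 0 ∈ Ioo (0:ℝ) (c.s 1)})
    (hFi : EqOn F.integrand (fun x => (√(1 - x 0 ^ 2))⁻¹ * (√(1 - m * x 0 ^ 2))⁻¹) F.domain) :
    (q : FormalPeriodRing) * toFormalPeriod (of F) = toFormalPeriod (of K) :=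
  (soloInformed_divChain_tiling c hm hma F hFd hFi q le_rfl K (by rw [hKd, c.top]) hKi).symm

/-- **`q·[F_p] = p·[K(m)]` in `P`**: the incomplete integral of the first kind up to the `p`-th
abscissa of a division chain of order `q` is equivalent under the KZ moves to `p/q` of the
complete one. [this work] -/
theorem soloInformed_divChain_torsion {m : ℝ} {q : ℕ} (c : SoloInformedDivChain m q)
    (hm : m ∈ Ioo (0:ℝ) 1) (hma : IsAlgebraic ℚ m) (K Fp : IntegralRep 1) {p : ℕ} (hp : p ≤ q)
    (hKd : K.domain = {x | x 0 ∈ Ioo (0:ℝ) 1})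
    (hKi : EqOn K.integrand (fun x => (√(1 - x 0 ^ 2))⁻¹ * (√(1 - m * x 0 ^ 2))⁻¹) K.domain)
    (hFpd : Fp.domain = {x | x 0 ∈ Ioo (0:ℝ) (c.s p)})
    (hFpi : EqOn Fp.integrand (fun x => (√(1 - x 0 ^ 2))⁻¹ * (√(1 - m * x 0 ^ 2))⁻¹) Fp.domain) :
    (q : FormalPeriodRing) * toFormalPeriod (of Fp) = (p : FormalPeriodRing) * toFormalPeriod (of K) := by
  obtain ⟨K₀, hK₀d, hK₀i⟩ := soloInformed_exists_ellipticK_rep m hm hma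
  have hSA : IsSemialgebraic ℚ {x : Fin 1 → ℝ | x 0 ∈ Ioo (0:ℝ) (c.s 1)} :=
    (isSemialgebraic_setOf_const_lt_apply isAlgebraic_zero 0).inter
      (isSemialgebraic_setOf_apply_lt_const c.one_isAlgebraic 0)
  have hsub : {x : Fin 1 → ℝ | x 0 ∈ Ioo (0:ℝ) (c.s 1)} ⊆ K₀.domain := fun x hx => by
    rw [hK₀d]; exact ⟨hx.1, hx.2.trans_le c.one_le⟩
  have hF := soloInformed_divChain_tiling c hm hma (K₀.restrict _ hSA hsub) rfl
    (fun x _ => hK₀i x)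
  rw [hF p hp Fp hFpd hFpi, hF q le_rfl K (by rw [hKd, c.top]) hKi]
  ring

/-- Numerically: `q·F_p.value = p·K(m)`. [this work] -/
theorem soloInformed_divChain_torsion_value {m : ℝ} {q : ℕ} (c : SoloInformedDivChain m q)
    (hm : m ∈ Ioo (0:ℝ) 1) (hma : IsAlgebraic ℚ m) (K Fp : IntegralRep 1) {p : ℕ} (hp : p ≤ q)
    (hKd : K.domain = {x | x 0 ∈ Ioo (0:ℝ) 1})
    (hKi : EqOn K.integrand (fun x => (√(1 - x 0 ^ 2))⁻¹ * (√(1 - m * x 0 ^ 2))⁻¹) K.domain)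
    (hFpd : Fp.domain = {x | x 0 ∈ Ioo (0:ℝ) (c.s p)})
    (hFpi : EqOn Fp.integrand (fun x => (√(1 - x 0 ^ 2))⁻¹ * (√(1 - m * x 0 ^ 2))⁻¹) Fp.domain) :
    (q : ℝ) * Fp.value = (p : ℝ) * K.value := by
  have h := congr_arg evalP (soloInformed_divChain_torsion c hm hma K Fp hp hKd hKi hFpd hFpi)
  rwa [map_mul, map_mul, evalP_toFormalPeriod_of, evalP_toFormalPeriod_of, map_natCast,
    map_natCast] at h

/-- **Existence of the incomplete representations `F_p = [(0,s_p), κ]`** along a chain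
(restrictions of `K(m)`). [this work] -/
theorem soloInformed_exists_divChain_rep {m : ℝ} {q : ℕ} (c : SoloInformedDivChain m q)
    (hm : m ∈ Ioo (0:ℝ) 1) (hma : IsAlgebraic ℚ m) {p : ℕ} (hp : p ≤ q) :
    ∃ Fp : IntegralRep 1, Fp.domain = {x | x 0 ∈ Ioo (0:ℝ) (c.s p)} ∧
      ∀ x, Fp.integrand x = (√(1 - x 0 ^ 2))⁻¹ * (√(1 - m * x 0 ^ 2))⁻¹ := by
  obtain ⟨K₀, hK₀d, hK₀i⟩ := soloInformed_exists_ellipticK_rep m hm hma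
  obtain ⟨hI, hpa⟩ := soloInformed_divChain_mem c hm hma p hp
  have hSA : IsSemialgebraic ℚ {x : Fin 1 → ℝ | x 0 ∈ Ioo (0:ℝ) (c.s p)} :=
    (isSemialgebraic_setOf_const_lt_apply isAlgebraic_zero 0).inter
      (isSemialgebraic_setOf_apply_lt_const hpa 0)
  have hsub : {x : Fin 1 → ℝ | x 0 ∈ Ioo (0:ℝ) (c.s p)} ⊆ K₀.domain := fun x hx => by
    rw [hK₀d]; exact ⟨hx.1, hx.2.trans_le hI.2⟩
  exact ⟨K₀.restrict _ hSA hsub, rfl, fun x => hK₀i x⟩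

end Summit.KontsevichZagierPeriods.KontsevichZagierPeriods.Theorems

end
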